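import Mathlib
import Summits.NavierStokesRegularity.NavierStokesRegularity.Theorems.FilamentSkeletonRssClause13KernelPackages
import Summits.NavierStokesRegularity.NavierStokesRegularity.Theorems.FilamentSkeletonRssClause13ProfileBumps

/-!
# Clause 13-J/13-R, brick n3 (KERNEL MOTHERS): the four mother kernels of the six-piece system, and differences of kernels

Route `FilamentSkeletonRss`, ∃-side clause 13 (`Clause13RNearStraightL` stmt-NavierStokesRegularity-23612; typing-agnostic).  Two book-keeping
results feeding the construction of the kernel system of `model_l2_estimate`:
* §1 `diff_package` — the facts for a difference `k₁ − k₂` of two kernels from the facts for `k₁, k₂` (derivative, continuity, integrability,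
  bound, transform, and the four moment INEQUALITIES `‖k₁−k₂‖₁ ≤ ‖k₁‖₁+‖k₂‖₁`, …);
* §2 `reMother_exists` — for any plateau `P_{α,β}` a mother kernel `r` (with `r′, r″`, the full fact package of `…Clause13KernelPackages`, profile
  `P_{α,β}(−z/2π)`); `bandMothers_exist` — mothers `r₂` (`P_{17/20,19/20}`), `r₃` (`P_{7/2,18/5}`) and the band pair `(α, β)` (`α` even, `β` odd;
  profile the one-sided band `V(z/2π)`), together with the PARTITION IDENTITY `r₃ = r₂ + 2α` (from `P_{7/2,18/5} − P_{17/20,19/20} = V + V(−·)`).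
  The mothers are `Re 𝓕⁻ψ` / `Im 𝓕⁻ψ` of the Schwartz profiles `ψ(ξ) = P(ξ)`, `ψ_B(ξ) = V(−ξ)`; the statements hide the Schwartz maps behind the
  existential.
Lane ns-filament-19175-p1 g17; `--supports stmt-NavierStokesRegularity-23612 --as helper`.
HONEST FRAMING: bookkeeping for a HYPOTHETICAL filament skeleton's model operator on the NEGATIVE side of a MODEL route; nothing here bears on
Navier–Stokes regularity or blow-up.
-/

noncomputable section

open MeasureTheory Real Complex Filter Set
open scoped FourierTransform ComplexConjugate Topology

namespace Summit.NavierStokesRegularity.NavierStokesRegularity.Theorems.MatchedKernel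
set_option linter.dupNamespace false

/-! ## §1 Differences of kernels -/

/-- `∫|f − g| ≤ ∫|f| + ∫|g|` and `∫|t|·|f − g| ≤ ∫|t||f| + ∫|t||g|` for integrable data. [folklore] -/
theorem integral_abs_sub_le_add {f g : ℝ → ℝ} (hf : Integrable f) (hg : Integrable g) (hf1 : Integrable fun t => t * f t)
    (hg1 : Integrable fun t => t * g t) :
    (∫ t, |f t - g t| ≤ (∫ t, |f t|) + ∫ t, |g t|) ∧ (∫ t, |t| * |f t - g t| ≤ (∫ t, |t| * |f t|) + ∫ t, |t| * |g t|) := by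
  have hf1' : Integrable fun t => |t| * |f t| := by
    refine hf1.abs.congr (ae_of_all _ fun t => ?_); simp only [abs_mul]
  have hg1' : Integrable fun t => |t| * |g t| := by
    refine hg1.abs.congr (ae_of_all _ fun t => ?_); simp only [abs_mul]
  constructor
  · rw [← integral_add hf.abs hg.abs]
    exact integral_mono_of_nonneg (ae_of_all _ fun t => abs_nonneg _) (hf.abs.add hg.abs) (ae_of_all _ fun t => abs_sub _ _)
  · rw [← integral_add hf1' hg1']
    refine integral_mono_of_nonneg (ae_of_all _ fun t => by positivity) (hf1'.add hg1') (ae_of_all _ fun t => ?_)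
    have h := abs_sub (f t) (g t)
    have ht : 0 ≤ |t| := abs_nonneg t
    nlinarith

/-- **Difference package**: from the facts for `k₁, k₂` to those for `k = k₁ − k₂` (`k′ = k₁′ − k₂′`). [folklore] -/
theorem diff_package {k₁ k₁' k₂ k₂' : ℝ → ℝ} (h₁ : ∀ t, HasDerivAt k₁ (k₁' t) t) (h₂ : ∀ t, HasDerivAt k₂ (k₂' t) t) (c₁ : Continuous k₁')
    (c₂ : Continuous k₂') (i₁ : Integrable k₁) (i₂ : Integrable k₂) (i₁' : Integrable k₁') (i₂' : Integrable k₂')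
    (m₁ : Integrable fun t => t * k₁ t) (m₂ : Integrable fun t => t * k₂ t) (m₁' : Integrable fun t => t * k₁' t)
    (m₂' : Integrable fun t => t * k₂' t) {M₁ M₂ : ℝ} (b₁ : ∀ t, |k₁ t| ≤ M₁) (b₂ : ∀ t, |k₂ t| ≤ M₂) {Φ₁ Φ₂ : ℝ → ℂ}
    (t₁ : ∀ z : ℝ, ∫ t : ℝ, ((k₁ t : ℝ) : ℂ) * cexp (I * z * t) = Φ₁ z) (t₂ : ∀ z : ℝ, ∫ t : ℝ, ((k₂ t : ℝ) : ℂ) * cexp (I * z * t) = Φ₂ z)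
    {k k' : ℝ → ℝ} (ek : ∀ t, k t = k₁ t - k₂ t) (ek' : ∀ t, k' t = k₁' t - k₂' t) :
    (∀ t, HasDerivAt k (k' t) t) ∧ Continuous k' ∧ Integrable k ∧ Integrable k' ∧ (Integrable fun t => t * k t) ∧
    (Integrable fun t => t * k' t) ∧ (∀ t, |k t| ≤ M₁ + M₂) ∧
    (∀ z : ℝ, ∫ t : ℝ, ((k t : ℝ) : ℂ) * cexp (I * z * t) = Φ₁ z - Φ₂ z) ∧
    (∫ t, |k t| ≤ (∫ t, |k₁ t|) + ∫ t, |k₂ t|) ∧ (∫ t, |t| * |k t| ≤ (∫ t, |t| * |k₁ t|) + ∫ t, |t| * |k₂ t|) ∧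
    (∫ t, |k' t| ≤ (∫ t, |k₁' t|) + ∫ t, |k₂' t|) ∧ (∫ t, |t| * |k' t| ≤ (∫ t, |t| * |k₁' t|) + ∫ t, |t| * |k₂' t|) := by
  have hk : k = fun t => k₁ t - k₂ t := funext ek
  have hk' : k' = fun t => k₁' t - k₂' t := funext ek'
  subst hk hk'
  have hm : Integrable fun t => t * (k₁ t - k₂ t) := (m₁.sub m₂).congr (ae_of_all _ fun t => by simp only [Pi.sub_apply]; ring)
  have hm' : Integrable fun t => t * (k₁' t - k₂' t) := (m₁'.sub m₂').congr (ae_of_all _ fun t => by simp only [Pi.sub_apply]; ring)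
  obtain ⟨hA, hB⟩ := integral_abs_sub_le_add i₁ i₂ m₁ m₂
  obtain ⟨hA', hB'⟩ := integral_abs_sub_le_add i₁' i₂' m₁' m₂'
  refine ⟨fun t => (h₁ t).sub (h₂ t), c₁.sub c₂, i₁.sub i₂, i₁'.sub i₂', hm, hm', fun t => ?_, fun z => ?_, hA, hB, hA', hB'⟩
  · exact (abs_sub _ _).trans (add_le_add (b₁ t) (b₂ t))
  · rw [← t₁ z, ← t₂ z, ← integral_sub (integrable_ofReal_mul_cexp i₁ z) (integrable_ofReal_mul_cexp i₂ z)]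
    refine integral_congr_ae (ae_of_all _ fun t => ?_)
    push_cast; ring

/-! ## §2 The mothers -/

/-- A plateau profile as a complex-valued Schwartz function of `ξ`. [folklore] -/
theorem plateauSchwartz_exists {α β : ℝ} (hα : 0 ≤ α) (h : α < β) :
    ∃ ψ : SchwartzMap ℝ ℂ, ∀ v, ψ v = (((smoothTransition ((β - v) / (β - α)) + smoothTransition ((β + v) / (β - α)) - 1 : ℝ)) : ℂ) := by
  have hc : HasCompactSupport fun ξ : ℝ => (((smoothTransition ((β - ξ) / (β - α)) + smoothTransition ((β + ξ) / (β - α)) - 1 : ℝ)) : ℂ) :=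
    (hasCompactSupport_plateau hα h).comp_left Complex.ofReal_zero
  have hs : ContDiff ℝ ((⊤ : ℕ∞) : WithTop ℕ∞)
      fun ξ : ℝ => (((smoothTransition ((β - ξ) / (β - α)) + smoothTransition ((β + ξ) / (β - α)) - 1 : ℝ)) : ℂ) :=
    Complex.ofRealCLM.contDiff.comp (contDiff_plateau α β)
  exact ⟨hc.toSchwartzMap hs, fun v => rfl⟩

/-- **A plateau mother exists**: for `0 ≤ α < β` there are `r, r′, r″` and bounds with the package of `reMother_package` and the profile
`∫ r e^{izt} = P_{α,β}(−z/(2π))`. [folklore] -/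
theorem reMother_exists {α β : ℝ} (hα : 0 ≤ α) (h : α < β) : ∃ (r r' r'' : ℝ → ℝ) (B₀ B₁ : ℝ),
    (∀ u, HasDerivAt r (r' u) u) ∧ (∀ u, HasDerivAt r' (r'' u) u) ∧ Continuous r' ∧ Continuous r'' ∧
      Integrable r ∧ (Integrable fun u => u * r u) ∧ Integrable r' ∧ (Integrable fun u => u * r' u) ∧ (Integrable fun u => u ^ 2 * r' u) ∧
      (Integrable fun u => u * r'' u) ∧ (Integrable fun u => u ^ 2 * r'' u) ∧ (∀ u, |r u| ≤ B₀) ∧ (∀ u, |u * r' u| ≤ B₁) ∧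
      (∀ z : ℝ, ∫ t : ℝ, ((r t : ℝ) : ℂ) * cexp (I * z * t)
        = (((smoothTransition ((β - (-z / (2 * π))) / (β - α)) + smoothTransition ((β + (-z / (2 * π))) / (β - α)) - 1 : ℝ)) : ℂ)) := by
  obtain ⟨ψ, hψ⟩ := plateauSchwartz_exists hα h
  have hre : ∀ v, conj (ψ v) = ψ v := fun v => by rw [hψ, Complex.conj_ofReal]
  have hev : ∀ v, ψ (-v) = ψ v := fun v => by rw [hψ, hψ]; exact_mod_cast plateau_neg α β v
  obtain ⟨a1, a2, a3, a4, a5, a6, a7, a8, a9, a10, a11, a12, a13, a14⟩ := reMother_package ψ hre hev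
    (r := fun u => ((𝓕⁻ ψ : SchwartzMap ℝ ℂ) u).re) (r' := fun u => (SchwartzMap.derivCLM ℝ ℂ (𝓕⁻ ψ : SchwartzMap ℝ ℂ) u).re)
    (r'' := fun u => (SchwartzMap.derivCLM ℝ ℂ (SchwartzMap.derivCLM ℝ ℂ (𝓕⁻ ψ : SchwartzMap ℝ ℂ)) u).re)
    (fun u => rfl) (fun u => rfl) (fun u => rfl)
  exact ⟨_, _, _, _, _, a1, a2, a3, a4, a5, a6, a7, a8, a9, a10, a11, a12, a13, fun z => by rw [a14 z, hψ]⟩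

/-- `𝓕⁻(f ∘ neg)(u) = 𝓕⁻f(−u)`. [folklore] -/
theorem fourierInv_comp_neg_apply (f : ℝ → ℂ) (u : ℝ) : 𝓕⁻ (fun ξ : ℝ => f (-ξ)) u = 𝓕⁻ f (-u) := by
  rw [Real.fourierInv_eq_fourier_comp_neg, Real.fourierInv_eq_fourier_neg, neg_neg]
  simp only [neg_neg]

/-- **The band mothers exist**: `r₂` (profile `P_{17/20,19/20}`), `r₃` (profile `P_{7/2,18/5}`) with their packages, the band pair `(α, β)` with
its package (profile `V(z/(2π))`), and the partition identity `r₃ = r₂ + 2α`. [folklore] -/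
theorem bandMothers_exist : ∃ (r₂ r₂' r₂'' r₃ r₃' r₃'' α α' β β' : ℝ → ℝ) (B₂₀ B₂₁ B₃₀ B₃₁ Bα Bβ : ℝ),
    ((∀ u, HasDerivAt r₂ (r₂' u) u) ∧ (∀ u, HasDerivAt r₂' (r₂'' u) u) ∧ Continuous r₂' ∧ Continuous r₂'' ∧
      Integrable r₂ ∧ (Integrable fun u => u * r₂ u) ∧ Integrable r₂' ∧ (Integrable fun u => u * r₂' u) ∧ (Integrable fun u => u ^ 2 * r₂' u) ∧
      (Integrable fun u => u * r₂'' u) ∧ (Integrable fun u => u ^ 2 * r₂'' u) ∧ (∀ u, |r₂ u| ≤ B₂₀) ∧ (∀ u, |u * r₂' u| ≤ B₂₁) ∧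
      (∀ z : ℝ, ∫ t : ℝ, ((r₂ t : ℝ) : ℂ) * cexp (I * z * t)
        = (((smoothTransition ((19 / 20 - (-z / (2 * π))) / (19 / 20 - 17 / 20))
            + smoothTransition ((19 / 20 + (-z / (2 * π))) / (19 / 20 - 17 / 20)) - 1 : ℝ)) : ℂ))) ∧
    ((∀ u, HasDerivAt r₃ (r₃' u) u) ∧ (∀ u, HasDerivAt r₃' (r₃'' u) u) ∧ Continuous r₃' ∧ Continuous r₃'' ∧
      Integrable r₃ ∧ (Integrable fun u => u * r₃ u) ∧ Integrable r₃' ∧ (Integrable fun u => u * r₃' u) ∧ (Integrable fun u => u ^ 2 * r₃' u) ∧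
      (Integrable fun u => u * r₃'' u) ∧ (Integrable fun u => u ^ 2 * r₃'' u) ∧ (∀ u, |r₃ u| ≤ B₃₀) ∧ (∀ u, |u * r₃' u| ≤ B₃₁) ∧
      (∀ z : ℝ, ∫ t : ℝ, ((r₃ t : ℝ) : ℂ) * cexp (I * z * t)
        = (((smoothTransition ((18 / 5 - (-z / (2 * π))) / (18 / 5 - 7 / 2))
            + smoothTransition ((18 / 5 + (-z / (2 * π))) / (18 / 5 - 7 / 2)) - 1 : ℝ)) : ℂ))) ∧
    ((∀ u, HasDerivAt α (α' u) u) ∧ Continuous α' ∧ Integrable α ∧ Integrable α' ∧ (Integrable fun u => u * α u) ∧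
      (Integrable fun u => u * α' u) ∧ (∀ u, |α u| ≤ Bα) ∧ (∀ u, α (-u) = α u) ∧
      (∀ u, HasDerivAt β (β' u) u) ∧ Continuous β' ∧ Integrable β ∧ Integrable β' ∧ (Integrable fun u => u * β u) ∧
      (Integrable fun u => u * β' u) ∧ (∀ u, |β u| ≤ Bβ) ∧ (∀ u, β (-u) = -β u) ∧
      (∀ z : ℝ, (∫ t : ℝ, ((α t : ℝ) : ℂ) * cexp (I * z * t)) + I * (∫ t : ℝ, ((β t : ℝ) : ℂ) * cexp (I * z * t))
        = (((smoothTransition ((18 / 5 - (z / (2 * π))) / (18 / 5 - 7 / 2))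
            - smoothTransition ((19 / 20 - (z / (2 * π))) / (19 / 20 - 17 / 20)) : ℝ)) : ℂ))) ∧
    (∀ u, r₃ u = r₂ u + 2 * α u) := by
  obtain ⟨Ψ2, eΨ2⟩ := plateauSchwartz_exists (α := 17 / 20) (β := 19 / 20) (by norm_num) (by norm_num)
  obtain ⟨Ψ3, eΨ3⟩ := plateauSchwartz_exists (α := 7 / 2) (β := 18 / 5) (by norm_num) (by norm_num)
  -- the one-sided band profile `ξ ↦ V(−ξ)` and its mirror `ξ ↦ V(ξ)`
  have hcB : HasCompactSupport fun ξ : ℝ => (((smoothTransition ((18 / 5 - -ξ) / (18 / 5 - 7 / 2))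
      - smoothTransition ((19 / 20 - -ξ) / (19 / 20 - 17 / 20)) : ℝ)) : ℂ) :=
    ((hasCompactSupport_bandProfile.comp_homeomorph (Homeomorph.neg ℝ))).comp_left Complex.ofReal_zero
  have hsB : ContDiff ℝ ((⊤ : ℕ∞) : WithTop ℕ∞) fun ξ : ℝ => (((smoothTransition ((18 / 5 - -ξ) / (18 / 5 - 7 / 2))
      - smoothTransition ((19 / 20 - -ξ) / (19 / 20 - 17 / 20)) : ℝ)) : ℂ) :=
    Complex.ofRealCLM.contDiff.comp (contDiff_bandProfile.comp contDiff_neg)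
  have hcBn : HasCompactSupport fun ξ : ℝ => (((smoothTransition ((18 / 5 - ξ) / (18 / 5 - 7 / 2))
      - smoothTransition ((19 / 20 - ξ) / (19 / 20 - 17 / 20)) : ℝ)) : ℂ) := hasCompactSupport_bandProfile.comp_left Complex.ofReal_zero
  have hsBn : ContDiff ℝ ((⊤ : ℕ∞) : WithTop ℕ∞) fun ξ : ℝ => (((smoothTransition ((18 / 5 - ξ) / (18 / 5 - 7 / 2))
      - smoothTransition ((19 / 20 - ξ) / (19 / 20 - 17 / 20)) : ℝ)) : ℂ) := Complex.ofRealCLM.contDiff.comp contDiff_bandProfile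
  set ΨB : SchwartzMap ℝ ℂ := hcB.toSchwartzMap hsB with hΨB
  set ΨBn : SchwartzMap ℝ ℂ := hcBn.toSchwartzMap hsBn with hΨBn
  have eΨB : ∀ v, ΨB v = (((smoothTransition ((18 / 5 - -v) / (18 / 5 - 7 / 2)) - smoothTransition ((19 / 20 - -v) / (19 / 20 - 17 / 20)) : ℝ)) : ℂ) :=
    fun v => rfl
  have eΨBn : ∀ v, ΨBn v = (((smoothTransition ((18 / 5 - v) / (18 / 5 - 7 / 2)) - smoothTransition ((19 / 20 - v) / (19 / 20 - 17 / 20)) : ℝ)) : ℂ) :=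
    fun v => rfl
  have hre2 : ∀ v, conj (Ψ2 v) = Ψ2 v := fun v => by rw [eΨ2, Complex.conj_ofReal]
  have hre3 : ∀ v, conj (Ψ3 v) = Ψ3 v := fun v => by rw [eΨ3, Complex.conj_ofReal]
  have hreB : ∀ v, conj (ΨB v) = ΨB v := fun v => by rw [eΨB, Complex.conj_ofReal]
  have hev2 : ∀ v, Ψ2 (-v) = Ψ2 v := fun v => by rw [eΨ2, eΨ2]; exact_mod_cast plateau_neg _ _ v
  have hev3 : ∀ v, Ψ3 (-v) = Ψ3 v := fun v => by rw [eΨ3, eΨ3]; exact_mod_cast plateau_neg _ _ v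
  obtain ⟨b1, b2, b3, b4, b5, b6, b7, b8, b9, b10, b11, b12, b13, b14⟩ := reMother_package Ψ2 hre2 hev2
    (r := fun u => ((𝓕⁻ Ψ2 : SchwartzMap ℝ ℂ) u).re) (r' := fun u => (SchwartzMap.derivCLM ℝ ℂ (𝓕⁻ Ψ2 : SchwartzMap ℝ ℂ) u).re)
    (r'' := fun u => (SchwartzMap.derivCLM ℝ ℂ (SchwartzMap.derivCLM ℝ ℂ (𝓕⁻ Ψ2 : SchwartzMap ℝ ℂ)) u).re)
    (fun u => rfl) (fun u => rfl) (fun u => rfl)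
  obtain ⟨c1, c2, c3, c4, c5, c6, c7, c8, c9, c10, c11, c12, c13, c14⟩ := reMother_package Ψ3 hre3 hev3
    (r := fun u => ((𝓕⁻ Ψ3 : SchwartzMap ℝ ℂ) u).re) (r' := fun u => (SchwartzMap.derivCLM ℝ ℂ (𝓕⁻ Ψ3 : SchwartzMap ℝ ℂ) u).re)
    (r'' := fun u => (SchwartzMap.derivCLM ℝ ℂ (SchwartzMap.derivCLM ℝ ℂ (𝓕⁻ Ψ3 : SchwartzMap ℝ ℂ)) u).re)
    (fun u => rfl) (fun u => rfl) (fun u => rfl)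
  obtain ⟨d1, d2, d3, d4, d5, d6, d7, d8, d9, d10, d11, d12, d13, d14, d15, d16, d17⟩ := bandMother_package ΨB hreB
    (α := fun u => ((𝓕⁻ ΨB : SchwartzMap ℝ ℂ) u).re) (α' := fun u => (SchwartzMap.derivCLM ℝ ℂ (𝓕⁻ ΨB : SchwartzMap ℝ ℂ) u).re)
    (β := fun u => ((𝓕⁻ ΨB : SchwartzMap ℝ ℂ) u).im) (β' := fun u => (SchwartzMap.derivCLM ℝ ℂ (𝓕⁻ ΨB : SchwartzMap ℝ ℂ) u).im)
    (fun u => rfl) (fun u => rfl) (fun u => rfl) (fun u => rfl)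
  -- the partition identity `Re 𝓕⁻Ψ3 = Re 𝓕⁻Ψ2 + 2 Re 𝓕⁻ΨB`
  have hsplit : Ψ3 = Ψ2 + ΨB + ΨBn := by
    ext v
    rw [add_apply, add_apply, eΨ3, eΨ2, eΨB, eΨBn]
    have h := congrArg (fun r : ℝ => (r : ℂ)) (plateau_sub_plateau_eq_band v)
    push_cast at h ⊢
    linear_combination h
  have hBn : ∀ u : ℝ, ((𝓕⁻ ΨBn : SchwartzMap ℝ ℂ) u).re = ((𝓕⁻ ΨB : SchwartzMap ℝ ℂ) u).re := by
    intro u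
    have hfun : ((ΨBn : SchwartzMap ℝ ℂ) : ℝ → ℂ) = (fun ξ => (ΨB : ℝ → ℂ) (-ξ)) := by
      funext ξ; rw [eΨBn]; show _ = ΨB (-ξ); rw [eΨB, neg_neg]
    have h1 : (𝓕⁻ ΨBn : SchwartzMap ℝ ℂ) u = (𝓕⁻ ((ΨBn : SchwartzMap ℝ ℂ) : ℝ → ℂ)) u := congrFun (SchwartzMap.fourierInv_coe ΨBn) u
    have h2 : (𝓕⁻ ΨB : SchwartzMap ℝ ℂ) (-u) = (𝓕⁻ ((ΨB : SchwartzMap ℝ ℂ) : ℝ → ℂ)) (-u) := congrFun (SchwartzMap.fourierInv_coe ΨB) (-u)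
    rw [h1, hfun, fourierInv_comp_neg_apply, ← h2, reKernel_even ΨB hreB u]
  have hpart : ∀ u : ℝ, ((𝓕⁻ Ψ3 : SchwartzMap ℝ ℂ) u).re = ((𝓕⁻ Ψ2 : SchwartzMap ℝ ℂ) u).re + 2 * ((𝓕⁻ ΨB : SchwartzMap ℝ ℂ) u).re := by
    intro u
    rw [hsplit, FourierTransform.fourierInv_add, FourierTransform.fourierInv_add, add_apply, add_apply,
      Complex.add_re, Complex.add_re, hBn u]
    ring
  refine ⟨_, _, _, _, _, _, _, _, _, _, _, _, _, _, _, _,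
    ⟨b1, b2, b3, b4, b5, b6, b7, b8, b9, b10, b11, b12, b13, fun z => ?_⟩,
    ⟨c1, c2, c3, c4, c5, c6, c7, c8, c9, c10, c11, c12, c13, fun z => ?_⟩,
    ⟨d1, d2, d3, d4, d5, d6, d7, d8, d9, d10, d11, d12, d13, d14, d15, d16, fun z => ?_⟩, hpart⟩
  · rw [b14 z, eΨ2]
  · rw [c14 z, eΨ3]
  · rw [d17 z, eΨB, neg_div, neg_neg]

end Summit.NavierStokesRegularity.NavierStokesRegularity.Theorems.MatchedKernel

end
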